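import Mathlib.Combinatorics.SimpleGraph.Acyclic
import Mathlib.Combinatorics.SimpleGraph.Metric
import Mathlib.Data.Real.Basic
import Mathlib.Data.ZMod.Basic
import Mathlib.Algebra.BigOperators.Fin
import Mathlib.Tactic.Ring
import Mathlib.Tactic.NormNum
import Mathlib.Tactic.Linarith
import Mathlib.Tactic.Push
import HarnessLib

/-!
# A forest on encounter points: "point to the closest admissible point of each branch, ties
# broken by labels" is acyclic — the deterministic core of the forest `F` in the proof of
# Timár 2006, Thm. 5.5

Barrier catalogue `Literature/Barriers/CriticalPhenomena/`; a deterministic brick of the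
programme proving Timár's Thm. 5.5 (`Timar2006_finiteLevelUnion`,
`TimarCriticalNonunimodular.lean`). In the proof of Thm. 5.5 (Á. Timár, *Percolation on
nonunimodular transitive graphs*, Ann. Probab. 34 (2006) 2344–2364, §5, p. 2359) a forest is
built on the set `W` of encounter points of `ω` lying in a class `L₀` of the 1-partition:

> "For every `v ∈ W` and each component `I` of `Γ_W ∖ v` such that `I` is adjacent to `v` in
> `Γ_W`, choose uniformly a vertex of `I` that is closest to `v` in `ω`. Put a directed edge from
> `v` to this vertex. Doing this for every `v ∈ W` and `I` as above, we obtain a digraph `M⃗`. …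
> There may be cycles in `M`, but any two cycles can share at most a vertex. … So, we can delete a
> uniformly chosen edge from each of the possibly arising pairwise edge-disjoint cycles in `M` to
> obtain a forest `F`."

We formalise a variant in which NO cycle deletion is needed: ties among the closest points are
broken by a labelling `ℓ` injective on `W` (i.i.d. uniform labels in the application) instead of
"uniformly", i.e. `v` points, in each branch, to the candidate minimising the key
`(dist_ω(v, ·), ℓ(·))` lexicographically. **Theorem (`targetGraph_isAcyclic`): the resulting
undirected graph is acyclic.** Proof (not in the source; replaces the cycle-deletion step): in a
cycle `x₀ … x_{k-1}` of `M`, (1) every cycle edge `{a, b}` with `a → b` is realised by an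
`ω`-geodesic avoiding every other cycle vertex `c` (else `c`, an admissible point of the same
branch strictly closer to `a`, would beat `b`), so the two cycle neighbours of `xᵢ` lie in the
same branch at `xᵢ`; (2) hence `xᵢ` points to at most one of them, and counting orientations
around the cycle, the cycle is consistently oriented; (3) then `dist(xᵢ, xᵢ₊₁) ≤ dist(xᵢ, xᵢ₋₁)`
all around, so all these distances agree, and the tie-break gives `ℓ(xᵢ₊₁) < ℓ(xᵢ₋₁)` all
around — impossible, as `i ↦ i + 2` returns to its start.

The setting is abstract: a host graph `Γ` (the open graph of `ω`), a set `W`, a "same class"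
relation `R` (symmetric and transitive), labels `ℓ : V → ℝ` injective on `W`; the branch of `u`
at `x` is reachability in `Γ` avoiding `x` (`AvoidReach`); candidates `cand Γ W R x u`, targets
`IsTarget`, the pointing relation `Points` and the undirected `targetGraph`. Also proved here:
targets are unique (`IsTarget.unique`) and depend only on the branch (`cand_eq_of_avoidReach`),
the input for "every point of `W` has degree `≥ 3`" in the next brick.

## References

* Á. Timár, Ann. Probab. 34 (2006) 2344–2364 (arXiv:math/0702875), §5, proof of Thm. 5.5
  (construction of `M⃗`, `M`, `F`). [Timar2006]
-/

namespace Literature.Barriers.CriticalPhenomena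

open SimpleGraph

variable {V : Type*}

/-! ### Reachability avoiding a vertex (the branches at `x`) -/

/-- `u` and `v` are joined in `Γ` by a walk avoiding the vertex `x` (for `u, v ≠ x`: they lie in
the same component of `Γ ∖ x`). [folklore] -/
def AvoidReach (Γ : SimpleGraph V) (x u v : V) : Prop :=
  ∃ p : Γ.Walk u v, x ∉ p.support

namespace AvoidReach

variable {Γ : SimpleGraph V} {x u v w : V}

/-- Reflexivity away from `x`. [folklore] -/
theorem refl (h : u ≠ x) : AvoidReach Γ x u u :=
  ⟨Walk.nil, by simpa using h.symm⟩

/-- Symmetry. [folklore] -/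
theorem symm (h : AvoidReach Γ x u v) : AvoidReach Γ x v u := by
  obtain ⟨p, hp⟩ := h
  exact ⟨p.reverse, by simpa using hp⟩

/-- Transitivity. [folklore] -/
theorem trans (h₁ : AvoidReach Γ x u v) (h₂ : AvoidReach Γ x v w) : AvoidReach Γ x u w := by
  obtain ⟨p, hp⟩ := h₁
  obtain ⟨q, hq⟩ := h₂
  exact ⟨p.append q, by simp [Walk.mem_support_append_iff, hp, hq]⟩

/-- The endpoints differ from `x`. [folklore] -/
theorem ne_left (h : AvoidReach Γ x u v) : u ≠ x := by
  obtain ⟨p, hp⟩ := h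
  exact fun huv => hp (huv ▸ p.start_mem_support)

/-- The endpoints differ from `x`. [folklore] -/
theorem ne_right (h : AvoidReach Γ x u v) : v ≠ x := by
  obtain ⟨p, hp⟩ := h
  exact fun huv => hp (huv ▸ p.end_mem_support)

/-- Avoiding reachability implies reachability. [folklore] -/
theorem reachable (h : AvoidReach Γ x u v) : Γ.Reachable u v := by
  obtain ⟨p, -⟩ := h
  exact ⟨p⟩

end AvoidReach

/-! ### Candidates, keys, targets, the pointing relation and the target graph -/

section Target

variable (Γ : SimpleGraph V) (W : Set V) (R : V → V → Prop) (ℓ : V → ℝ)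

/-- The **candidates** for the target of `x` in the branch of `u` at `x`: points of `W` in the
class of `x`, reachable from `x`, and lying in the branch of `u` ("each component `I` … adjacent
to `v`", restricted to `W ∩ L₀`). [cite: Timar2006, Thm. 5.5 (proof: construction of M⃗)] -/
def cand (x u : V) : Set V :=
  {z | AvoidReach Γ x u z ∧ Γ.Reachable x z ∧ z ∈ W ∧ R x z}

/-- The lexicographic key order "closer to `x`, ties broken by the label": `t` beats `z`.
[cite: Timar2006, Thm. 5.5 (proof: "a vertex of I that is closest to v", ties)] -/
def KeyLE (x t z : V) : Prop :=
  Γ.edist x t < Γ.edist x z ∨ (Γ.edist x t = Γ.edist x z ∧ ℓ t ≤ ℓ z)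

/-- `t` is **the target** of `x` in the branch of `u`: a candidate beating every candidate.
[cite: Timar2006, Thm. 5.5 (proof: construction of M⃗)] -/
def IsTarget (x u t : V) : Prop :=
  t ∈ cand Γ W R x u ∧ ∀ z ∈ cand Γ W R x u, KeyLE Γ ℓ x t z

/-- The **pointing relation** of `M⃗`: `x ∈ W` points to `t` if `t` is its target in some branch.
[cite: Timar2006, Thm. 5.5 (proof: the digraph M⃗)] -/
def Points (x t : V) : Prop :=
  x ∈ W ∧ ∃ u, IsTarget Γ W R ℓ x u t

/-- The **target graph** `M`: the pointing relation with directions forgotten.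
[cite: Timar2006, Thm. 5.5 (proof: "Denote by M the graph that results from ignoring the directions")] -/
def targetGraph : SimpleGraph V where
  Adj a b := a ≠ b ∧ (Points Γ W R ℓ a b ∨ Points Γ W R ℓ b a)
  symm := ⟨fun _ _ h => ⟨h.1.symm, h.2.symm⟩⟩
  loopless := ⟨fun _ h => h.1 rfl⟩

variable {Γ W R ℓ}

/-- Candidates depend only on the branch. [folklore] -/
theorem cand_eq_of_avoidReach {x u u' : V} (h : AvoidReach Γ x u u') :
    cand Γ W R x u = cand Γ W R x u' := by
  ext z
  exact ⟨fun ⟨hz, hr⟩ => ⟨h.symm.trans hz, hr⟩, fun ⟨hz, hr⟩ => ⟨h.trans hz, hr⟩⟩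

/-- A target is a candidate: in the branch, reachable, in `W`, in the class. [folklore] -/
theorem IsTarget.mem {x u t : V} (h : IsTarget Γ W R ℓ x u t) : t ∈ cand Γ W R x u := h.1

/-- **Targets are unique** (labels injective on `W`). [folklore] -/
theorem IsTarget.unique (hℓ : Set.InjOn ℓ W) {x u t t' : V} (h : IsTarget Γ W R ℓ x u t)
    (h' : IsTarget Γ W R ℓ x u t') : t = t' := by
  have h1 := h.2 t' h'.1
  have h2 := h'.2 t h.1
  unfold KeyLE at h1 h2
  have hℓeq : ℓ t = ℓ t' := by
    rcases h1 with h1 | ⟨h1, h1'⟩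
    · rcases h2 with h2 | ⟨h2, -⟩
      · exact absurd (h1.trans h2) (lt_irrefl _)
      · exact absurd (h2 ▸ h1) (lt_irrefl _)
    · rcases h2 with h2 | ⟨-, h2'⟩
      · exact absurd (h1 ▸ h2) (lt_irrefl _)
      · exact le_antisymm h1' h2'
  exact hℓ h.1.2.2.1 h'.1.2.2.1 hℓeq

/-- A target strictly beats every other candidate. [folklore] -/
theorem IsTarget.key_lt (hℓ : Set.InjOn ℓ W) {x u t z : V} (h : IsTarget Γ W R ℓ x u t)
    (hz : z ∈ cand Γ W R x u) (hne : z ≠ t) :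
    Γ.edist x t < Γ.edist x z ∨ (Γ.edist x t = Γ.edist x z ∧ ℓ t < ℓ z) := by
  rcases h.2 z hz with h1 | ⟨h1, h2⟩
  · exact Or.inl h1
  · refine Or.inr ⟨h1, lt_of_le_of_ne h2 fun heq => hne (hℓ hz.2.2.1 h.1.2.2.1 heq.symm)⟩

/-! ### Geodesics to the target avoid the other admissible points -/

/-- A vertex `c ≠ t` on a geodesic from `x` to its target `t`, with `c ∈ W` in the class of
`x`, must be `x` itself: otherwise `c` is a candidate of the same branch strictly closer to `x`.
[cite: Timar2006, Thm. 5.5 (proof: "a vertex of I that is closest to v")] -/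
theorem IsTarget.eq_of_geodesic {x u t c : V} (h : IsTarget Γ W R ℓ x u t) (hcW : c ∈ W)
    (hRc : R x c) (hct : c ≠ t) (hgeo : Γ.edist x c + Γ.edist c t = Γ.edist x t) : c = x := by
  classical
  by_contra hcx
  obtain ⟨hbr, hreach, -, -⟩ := h.1
  have hxt : Γ.edist x t ≠ ⊤ := fun htop =>
    hreach.elim fun p => (lt_of_le_of_lt (edist_le p) (WithTop.coe_lt_top p.length)).ne htop
  have hxc : Γ.edist x c ≠ ⊤ := fun htop => hxt (by rw [← hgeo, htop, top_add])
  have hctT : Γ.edist c t ≠ ⊤ := fun htop => hxt (by rw [← hgeo, htop, add_top])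
  -- a geodesic from `c` to `t` avoids `x`
  have hbr' : AvoidReach Γ x c t := by
    obtain ⟨q, hq⟩ := exists_walk_of_edist_ne_top hctT
    refine ⟨q, fun hxq => ?_⟩
    have hsplit := congrArg Walk.length (q.take_spec hxq)
    rw [Walk.length_append] at hsplit
    have h1 : Γ.edist c x ≤ (q.takeUntil x hxq).length := edist_le _
    have h2 : Γ.edist x t ≤ (q.dropUntil x hxq).length := edist_le _
    have h3 : Γ.edist c x + Γ.edist x t ≤ q.length := by
      calc Γ.edist c x + Γ.edist x t ≤ ((q.takeUntil x hxq).length : ℕ∞) + (q.dropUntil x hxq).length :=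
            add_le_add h1 h2
        _ = q.length := by rw [← hsplit, Nat.cast_add]
    rw [hq] at h3
    -- `edist x t = edist x c + edist c t ≥ 1 + edist c t > edist c t ≥ edist c x + edist x t`
    have h4 : Γ.edist x t ≤ Γ.edist c t := le_trans le_add_self h3
    have h5 : 1 ≤ Γ.edist x c := Order.one_le_iff_pos.2 (edist_pos_of_ne (Ne.symm hcx))
    have h6 : 1 + Γ.edist c t ≤ Γ.edist c t := by
      calc 1 + Γ.edist c t ≤ Γ.edist x c + Γ.edist c t := add_le_add h5 le_rfl
        _ = Γ.edist x t := hgeo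
        _ ≤ Γ.edist c t := h4
    have : (1 : ℕ∞) + Γ.edist c t ≤ 0 + Γ.edist c t := by rwa [zero_add]
    have h10 : (1 : ℕ∞) ≤ 0 := (WithTop.add_le_add_iff_right hctT).1 this
    exact absurd h10 (not_le.2 zero_lt_one)
  -- so `c` is a candidate strictly closer than `t`
  have hcand : c ∈ cand Γ W R x u := ⟨(hbr.trans hbr'.symm), reachable_of_edist_ne_top hxc, hcW, hRc⟩
  have hlt : Γ.edist x c < Γ.edist x t := by
    rw [← hgeo]
    have h5 : 1 ≤ Γ.edist c t := Order.one_le_iff_pos.2 (edist_pos_of_ne hct)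
    calc Γ.edist x c < Γ.edist x c + 1 := ENat.lt_add_one_iff hxc |>.2 le_rfl
      _ ≤ Γ.edist x c + Γ.edist c t := add_le_add le_rfl h5
  rcases h.2 c hcand with h1 | ⟨h1, -⟩
  · exact absurd (h1.trans hlt) (lt_irrefl _)
  · exact absurd (h1 ▸ hlt) (lt_irrefl _)

/-- **The pointing edge `a → b` is realised inside the branch of every other admissible point**:
if `a` points to `b` and `c ∈ W ∖ {a, b}` is in the class of `a`, then `a` and `b` are joined in
`Γ` avoiding `c` (a geodesic from `a` to `b` cannot pass through `c`). [folklore] -/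
theorem Points.avoidReach {a b c : V} (h : Points Γ W R ℓ a b) (hcW : c ∈ W) (hRc : R a c)
    (hca : c ≠ a) (hcb : c ≠ b) : AvoidReach Γ c a b := by
  classical
  obtain ⟨-, u, ht⟩ := h
  obtain ⟨-, hreach, -, -⟩ := ht.1
  have habT : Γ.edist a b ≠ ⊤ := fun htop =>
    hreach.elim fun p => (lt_of_le_of_lt (edist_le p) (WithTop.coe_lt_top p.length)).ne htop
  obtain ⟨P, hP⟩ := exists_walk_of_edist_ne_top habT
  refine ⟨P, fun hcP => hca (ht.eq_of_geodesic hcW hRc hcb ?_)⟩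
  -- `c` on the geodesic `P`: `edist a c + edist c b = edist a b`
  have hsplit := congrArg Walk.length (P.take_spec hcP)
  rw [Walk.length_append] at hsplit
  have h1 : Γ.edist a c ≤ (P.takeUntil c hcP).length := edist_le _
  have h2 : Γ.edist c b ≤ (P.dropUntil c hcP).length := edist_le _
  refine le_antisymm ?_ SimpleGraph.edist_triangle
  calc Γ.edist a c + Γ.edist c b ≤ ((P.takeUntil c hcP).length : ℕ∞) + (P.dropUntil c hcP).length :=
        add_le_add h1 h2
    _ = P.length := by rw [← hsplit, Nat.cast_add]
    _ = Γ.edist a b := hP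

/-- An edge of the target graph joins points of `W`. [folklore] -/
theorem targetGraph_adj_mem {a b : V} (h : (targetGraph Γ W R ℓ).Adj a b) : a ∈ W ∧ b ∈ W := by
  rcases h.2 with ⟨ha, u, ht⟩ | ⟨hb, u, ht⟩
  · exact ⟨ha, ht.1.2.2.1⟩
  · exact ⟨ht.1.2.2.1, hb⟩

/-- An edge of the target graph joins points of a common class (`R` symmetric). [folklore] -/
theorem targetGraph_adj_rel (hRs : ∀ {a b}, R a b → R b a) {a b : V} (h : (targetGraph Γ W R ℓ).Adj a b) : R a b := by
  rcases h.2 with ⟨-, u, ht⟩ | ⟨-, u, ht⟩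
  · exact ht.1.2.2.2
  · exact hRs ht.1.2.2.2

end Target

/-! ### The cyclic counting argument -/

section Cyclic

variable {n : ℕ}

/-- In `ZMod n` with `3 ≤ n`, `i - 1 ≠ i + 1`. [folklore] -/
theorem ZMod.sub_one_ne_add_one (hn : 3 ≤ n) (i : ZMod n) : i - 1 ≠ i + 1 := by
  intro h
  have h2 : ((2 : ℕ) : ZMod n) = 0 := by
    have : i + 1 - (i - 1) = 0 := by rw [← h, sub_self]
    calc ((2 : ℕ) : ZMod n) = i + 1 - (i - 1) := by push_cast; ring
      _ = 0 := this
  rw [ZMod.natCast_eq_zero_iff] at h2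
  have := Nat.le_of_dvd (by norm_num) h2
  omega

/-- In `ZMod n` with `2 ≤ n`, `i ≠ i + 1`. [folklore] -/
theorem ZMod.self_ne_add_one (hn : 2 ≤ n) (i : ZMod n) : i ≠ i + 1 := by
  intro h
  have h1 : ((1 : ℕ) : ZMod n) = 0 := by
    calc ((1 : ℕ) : ZMod n) = i + 1 - i := by push_cast; ring
      _ = 0 := by rw [← h, sub_self]
  rw [ZMod.natCast_eq_zero_iff] at h1
  have := Nat.le_of_dvd (by norm_num) h1
  omega

variable [NeZero n]

/-- **The cyclic counting lemma, oriented form.** On a cycle `x : ZMod n → V` (`n ≥ 3`) suppose: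
every cycle edge carries at least one orientation of `Pt`; no vertex points to both of its cycle
neighbours; a vertex pointing forward has a strictly smaller key forward than backward; and
`x 0` points to `x 1`. Then `False`: the cycle is consistently oriented forward, the symmetric
distances `d` are constant around it, and the labels decrease strictly along `i ↦ i + 2`.
[folklore] -/
theorem cyclic_false_of_forward (hn : 3 ≤ n) {x : ZMod n → V} {Pt : V → V → Prop}
    (hadj : ∀ i, Pt (x i) (x (i + 1)) ∨ Pt (x (i + 1)) (x i))
    (hout : ∀ i, ¬ (Pt (x i) (x (i - 1)) ∧ Pt (x i) (x (i + 1))))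
    {d : V → V → ℕ∞} (hd : ∀ a b, d a b = d b a) {ℓ : V → ℝ}
    (hkey : ∀ i, Pt (x i) (x (i + 1)) →
      d (x i) (x (i + 1)) < d (x i) (x (i - 1)) ∨
        (d (x i) (x (i + 1)) = d (x i) (x (i - 1)) ∧ ℓ (x (i + 1)) < ℓ (x (i - 1))))
    (h0 : Pt (x 0) (x 1)) : False := by
  classical
  -- orientation counting: `Σ_i ([i → i+1] + [i → i-1]) = Σ_i ([i → i+1] + [i+1 → i]) ≥ n`
  let f : ZMod n → ℕ := fun i => if Pt (x i) (x (i + 1)) then 1 else 0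
  let g : ZMod n → ℕ := fun i => if Pt (x (i + 1)) (x i) then 1 else 0
  let b : ZMod n → ℕ := fun i => if Pt (x i) (x (i - 1)) then 1 else 0
  have hbg : ∑ i, b i = ∑ i, g i := by
    refine Fintype.sum_equiv (Equiv.subRight (1 : ZMod n)) b g fun i => ?_
    simp only [b, g, Equiv.subRight_apply, sub_add_cancel]
  have hle : ∀ i, f i + b i ≤ 1 := by
    intro i
    have := hout i
    simp only [f, b]
    split_ifs with h1 h2 <;> simp_all
  have hge : ∀ i, 1 ≤ f i + g i := by
    intro i
    simp only [f, g]
    rcases hadj i with h | h <;> simp [h]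
  have hsum : ∑ i, (f i + g i) ≤ ∑ i, (f i + b i) := by
    rw [Finset.sum_add_distrib, Finset.sum_add_distrib, hbg]
  have heq : ∀ i, f i + g i = 1 := by
    have h1 : ∑ i, (f i + g i) ≤ ∑ _i : ZMod n, 1 := hsum.trans (Finset.sum_le_sum fun i _ => hle i)
    intro i
    by_contra hne
    have hlt : 1 < f i + g i := lt_of_le_of_ne (hge i) (Ne.symm hne)
    have : ∑ _i : ZMod n, (1 : ℕ) < ∑ i, (f i + g i) :=
      Finset.sum_lt_sum (fun j _ => hge j) ⟨i, Finset.mem_univ i, hlt⟩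
    exact absurd h1 (not_le.2 this)
  have heq' : ∀ i, f i + b i = 1 := by
    have h1 : ∑ _i : ZMod n, (1 : ℕ) ≤ ∑ i, (f i + b i) :=
      (Finset.sum_le_sum fun i _ => hge i).trans hsum
    intro i
    by_contra hne
    have hlt : f i + b i < 1 := lt_of_le_of_ne (hle i) hne
    have : ∑ i, (f i + b i) < ∑ _i : ZMod n, (1 : ℕ) :=
      Finset.sum_lt_sum (fun j _ => hle j) ⟨i, Finset.mem_univ i, hlt⟩
    exact absurd h1 (not_le.2 this)
  -- exactly one orientation per edge; consistent forward orientation by induction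
  have hfwd_step : ∀ i, Pt (x i) (x (i + 1)) → Pt (x (i + 1)) (x (i + 1 + 1)) := by
    intro i hi
    have h1 : ¬ Pt (x (i + 1)) (x i) := by
      intro h'
      have := heq i
      simp only [f, g, if_pos hi, if_pos h'] at this
      omega
    have h2 := heq' (i + 1)
    simp only [f, b, add_sub_cancel_right, if_neg h1, add_zero] at h2
    by_contra h
    rw [if_neg h] at h2
    omega
  have hfwd : ∀ i, Pt (x i) (x (i + 1)) := by
    have hnat : ∀ k : ℕ, Pt (x (k : ZMod n)) (x ((k : ZMod n) + 1)) := by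
      intro k
      induction k with
      | zero => simpa using h0
      | succ k ih =>
        have := hfwd_step _ ih
        push_cast
        exact this
    intro i
    have := hnat i.val
    rwa [ZMod.natCast_zmod_val] at this
  -- distances are constant around the cycle
  let D : ZMod n → ℕ∞ := fun i => d (x i) (x (i + 1))
  have hmono : ∀ i, D i ≤ D (i - 1) := by
    intro i
    have hk := hkey i (hfwd i)
    have : d (x i) (x (i - 1)) = D (i - 1) := by simp only [D, sub_add_cancel, hd]
    rw [this] at hk
    rcases hk with hk | ⟨hk, -⟩
    · exact hk.le
    · exact hk.le
  have hconst : ∀ i, D i = D (i - 1) := by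
    have hiter : ∀ (k : ℕ) (i : ZMod n), D i ≤ D (i - (k : ZMod n)) := by
      intro k
      induction k with
      | zero => intro i; simp
      | succ k ih =>
        intro i
        calc D i ≤ D (i - 1) := hmono i
          _ ≤ D (i - 1 - (k : ZMod n)) := ih (i - 1)
          _ = D (i - ((k + 1 : ℕ) : ZMod n)) := by congr 1; push_cast; ring
    intro i
    refine le_antisymm (hmono i) ?_
    have h := hiter (n - 1) (i - 1)
    have hcast : ((n - 1 : ℕ) : ZMod n) = -1 := by
      have h1 : ((n - 1 : ℕ) : ZMod n) + 1 = 0 := by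
        have : ((n - 1 + 1 : ℕ) : ZMod n) = 0 := by rw [Nat.sub_add_cancel (by omega), ZMod.natCast_self]
        push_cast at this
        exact this
      calc ((n - 1 : ℕ) : ZMod n) = ((n - 1 : ℕ) : ZMod n) + 1 - 1 := by ring
        _ = -1 := by rw [h1]; ring
    rw [hcast] at h
    have e : i - 1 - (-1 : ZMod n) = i := by ring
    rwa [e] at h
  -- labels decrease strictly along `j ↦ j + 2`
  have hlab : ∀ j, ℓ (x (j + 2)) < ℓ (x j) := by
    intro j
    have hk := hkey (j + 1) (hfwd (j + 1))
    have h1 : d (x (j + 1)) (x (j + 1 - 1)) = D j := by simp only [D, add_sub_cancel_right, hd]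
    have h2 : d (x (j + 1)) (x (j + 1 + 1)) = D (j + 1) := rfl
    rw [h1, h2, hconst (j + 1), add_sub_cancel_right] at hk
    rcases hk with hk | ⟨-, hk⟩
    · exact absurd hk (lt_irrefl _)
    · have e1 : j + 1 + 1 = j + 2 := by ring
      rwa [e1] at hk
  have hchain : ∀ k : ℕ, ℓ (x ((2 * (k + 1) : ℕ) : ZMod n)) < ℓ (x 0) := by
    intro k
    induction k with
    | zero => simpa using hlab 0
    | succ k ih =>
      have hstep : ℓ (x ((2 * (k + 1 + 1) : ℕ) : ZMod n)) < ℓ (x ((2 * (k + 1) : ℕ) : ZMod n)) := by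
        have := hlab ((2 * (k + 1) : ℕ) : ZMod n)
        have e : ((2 * (k + 1 + 1) : ℕ) : ZMod n) = ((2 * (k + 1) : ℕ) : ZMod n) + 2 := by
          push_cast; ring
        rwa [e]
      exact hstep.trans ih
  have h := hchain (n - 1)
  have e : ((2 * (n - 1 + 1) : ℕ) : ZMod n) = 0 := by
    rw [Nat.sub_add_cancel (by omega), Nat.cast_mul, ZMod.natCast_self, mul_zero]
  rw [e] at h
  exact lt_irrefl _ h

/-- **The cyclic counting lemma.** As `cyclic_false_of_forward`, without the normalisation
`x 0 → x 1`: some vertex points somewhere (orientation count), and the hypotheses are symmetric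
under reversing and rotating the cycle. [folklore] -/
theorem cyclic_false (hn : 3 ≤ n) {x : ZMod n → V} {Pt : V → V → Prop}
    (hadj : ∀ i, Pt (x i) (x (i + 1)) ∨ Pt (x (i + 1)) (x i))
    (hout : ∀ i, ¬ (Pt (x i) (x (i - 1)) ∧ Pt (x i) (x (i + 1))))
    {d : V → V → ℕ∞} (hd : ∀ a b, d a b = d b a) {ℓ : V → ℝ}
    (hkey : ∀ i, Pt (x i) (x (i + 1)) →
      d (x i) (x (i + 1)) < d (x i) (x (i - 1)) ∨
        (d (x i) (x (i + 1)) = d (x i) (x (i - 1)) ∧ ℓ (x (i + 1)) < ℓ (x (i - 1))))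
    (hkey' : ∀ i, Pt (x i) (x (i - 1)) →
      d (x i) (x (i - 1)) < d (x i) (x (i + 1)) ∨
        (d (x i) (x (i - 1)) = d (x i) (x (i + 1)) ∧ ℓ (x (i - 1)) < ℓ (x (i + 1)))) : False := by
  -- forward case, rotated to start at `i₀`
  have hF : ∀ i₀, Pt (x i₀) (x (i₀ + 1)) → False := by
    intro i₀ h
    refine cyclic_false_of_forward hn (x := fun i => x (i₀ + i)) (Pt := Pt) (d := d) (ℓ := ℓ)
      (fun i => ?_) (fun i => ?_) hd (fun i hi => ?_) (by simpa using h)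
    · have := hadj (i₀ + i)
      have e : i₀ + (i + 1) = i₀ + i + 1 := by ring
      simp only [e]
      exact this
    · have := hout (i₀ + i)
      have e1 : i₀ + (i - 1) = i₀ + i - 1 := by ring
      have e2 : i₀ + (i + 1) = i₀ + i + 1 := by ring
      simp only [e1, e2]
      exact this
    · have e1 : i₀ + (i + 1) = i₀ + i + 1 := by ring
      have e2 : i₀ + (i - 1) = i₀ + i - 1 := by ring
      simp only [e1, e2] at hi ⊢
      exact hkey (i₀ + i) hi
  -- backward case, reversed and rotated: `y i = x (i₀ - i)` points forward at `0`
  have hB : ∀ i₀, Pt (x i₀) (x (i₀ - 1)) → False := by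
    intro i₀ h
    refine cyclic_false_of_forward hn (x := fun i => x (i₀ - i)) (Pt := Pt) (d := d) (ℓ := ℓ)
      (fun i => ?_) (fun i => ?_) hd (fun i hi => ?_) (by simpa using h)
    · have := hadj (i₀ - i - 1)
      have e : i₀ - i - 1 + 1 = i₀ - i := by ring
      have e2 : i₀ - (i + 1) = i₀ - i - 1 := by ring
      rw [e] at this
      simp only [e2]
      exact this.symm
    · have := hout (i₀ - i)
      have e1 : i₀ - (i - 1) = i₀ - i + 1 := by ring
      have e2 : i₀ - (i + 1) = i₀ - i - 1 := by ring
      simp only [e1, e2]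
      exact fun ⟨h1, h2⟩ => this ⟨h2, h1⟩
    · have e1 : i₀ - (i - 1) = i₀ - i + 1 := by ring
      have e2 : i₀ - (i + 1) = i₀ - i - 1 := by ring
      simp only [e1, e2] at hi ⊢
      exact hkey' (i₀ - i) hi
  -- some vertex points somewhere
  rcases hadj 0 with h | h
  · exact hF 0 (by simpa using h)
  · refine hB (0 + 1) ?_
    have e2 : (0 : ZMod n) + 1 - 1 = 0 := by ring
    rw [e2]; exact h

end Cyclic

/-! ### The target graph is acyclic -/

section Acyclic

variable {Γ : SimpleGraph V} {W : Set V} {R : V → V → Prop} {ℓ : V → ℝ}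

/-- Along a walk in the target graph all vertices are in `W`, and the endpoints are in one class
(`R` symmetric and transitive). [folklore] -/
theorem targetGraph_walk_rel (hRs : ∀ {a b}, R a b → R b a) (hRt : ∀ {a b c}, R a b → R b c → R a c)
    {a b : V} (p : (targetGraph Γ W R ℓ).Walk a b) (hp : 0 < p.length) :
    R a b ∧ a ∈ W ∧ b ∈ W := by
  induction p with
  | nil => simp at hp
  | @cons u v w hadj q ih =>
    have h1 := targetGraph_adj_rel hRs hadj
    have h2 := targetGraph_adj_mem hadj
    by_cases hq : 0 < q.length
    · obtain ⟨h3, -, h4⟩ := ih hq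
      exact ⟨hRt h1 h3, h2.1, h4⟩
    · have hq0 : q.length = 0 := by omega
      have hvw : v = w := Walk.eq_of_length_eq_zero hq0
      subst hvw
      exact ⟨h1, h2.1, h2.2⟩

/-- Consecutive points of a walk in the target graph avoiding `c ∈ W` (of the common class) are
joined in `Γ` avoiding `c`; hence so are its endpoints. [folklore] -/
theorem targetGraph_walk_avoidReach (hRs : ∀ {a b}, R a b → R b a)
    (hRt : ∀ {a b c}, R a b → R b c → R a c) {c : V} (hcW : c ∈ W)
    {a b : V} (p : (targetGraph Γ W R ℓ).Walk a b) (hc : c ∉ p.support) (hRc : R a c)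
    (ha : a ≠ c) : AvoidReach Γ c a b := by
  induction p with
  | nil => exact AvoidReach.refl ha
  | @cons u v w hadj q ih =>
    rw [Walk.support_cons, List.mem_cons, not_or] at hc
    have hvc : v ≠ c := fun h => hc.2 (h ▸ q.start_mem_support)
    have hRuv : R u v := targetGraph_adj_rel hRs hadj
    have hRvc : R v c := hRt (hRs hRuv) hRc
    have h1 : AvoidReach Γ c u v := by
      rcases hadj.2 with h | h
      · exact h.avoidReach hcW hRc (Ne.symm ha) (Ne.symm hvc)
      · exact (h.avoidReach hcW hRvc (Ne.symm hvc) (Ne.symm ha)).symm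
    exact h1.trans (ih hc.2 hRvc hvc)

/-- **The target graph is acyclic** (`R` symmetric and transitive, `ℓ` injective on `W`): the
variant of Timár's forest `F` with label tie-breaking needs no cycle deletion. See the module
docstring for the proof. [cite: Timar2006, Thm. 5.5 (proof: the forest F on the encounter points)] -/
theorem targetGraph_isAcyclic (hRs : ∀ {a b}, R a b → R b a)
    (hRt : ∀ {a b c}, R a b → R b c → R a c) (hℓ : Set.InjOn ℓ W) :
    (targetGraph Γ W R ℓ).IsAcyclic := by
  classical
  rw [isAcyclic_iff_forall_adj_isBridge]
  intro v w hvw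
  rw [isBridge_iff]
  intro hreach
  -- a path from `v` to `w` avoiding the edge `vw`, closed up by the edge: a cycle of length `n ≥ 3`
  obtain ⟨P'⟩ := hreach
  let P := P'.bypass
  have hP : P.IsPath := P'.bypass_isPath
  have hle : (targetGraph Γ W R ℓ).deleteEdges {s(v, w)} ≤ targetGraph Γ W R ℓ := deleteEdges_le _
  have hlen2 : 2 ≤ P.length := by
    by_contra hlt
    have hlt' : P.length ≤ 1 := by omega
    rcases Nat.le_one_iff_eq_zero_or_eq_one.1 hlt' with h | h
    · exact hvw.1 (Walk.eq_of_length_eq_zero h)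
    · have hadj : ((targetGraph Γ W R ℓ).deleteEdges {s(v, w)}).Adj (P.getVert 0) (P.getVert 1) :=
        P.adj_getVert_succ (by omega)
      rw [Walk.getVert_zero, show P.getVert 1 = w by rw [← h]; exact P.getVert_length] at hadj
      rw [deleteEdges_adj] at hadj
      exact hadj.2 rfl
  set n := P.length + 1 with hn
  have hn3 : 3 ≤ n := by omega
  haveI : NeZero n := ⟨by omega⟩
  haveI : Fact (1 < n) := ⟨by omega⟩
  let x : ZMod n → V := fun i => P.getVert i.val
  -- the successor index, concretely
  have hval_succ : ∀ i : ZMod n, (i + 1).val = if i.val = P.length then 0 else i.val + 1 := by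
    intro i
    rw [ZMod.val_add, ZMod.val_one]
    split_ifs with h
    · rw [h, hn, Nat.mod_self]
    · exact Nat.mod_eq_of_lt (by have := i.val_lt; omega)
  -- cyclic adjacency in `M`
  have hcyc : ∀ i : ZMod n, (targetGraph Γ W R ℓ).Adj (x i) (x (i + 1)) := by
    intro i
    show (targetGraph Γ W R ℓ).Adj (P.getVert i.val) (P.getVert (i + 1).val)
    rw [hval_succ]
    split_ifs with h
    · rw [h, P.getVert_length, P.getVert_zero]
      exact hvw.symm
    · exact hle (P.adj_getVert_succ (by have := i.val_lt; omega))
  have hinj : Function.Injective x := by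
    intro i j hij
    have := hP.getVert_injOn (by have := i.val_lt; simp only [Set.mem_setOf_eq]; omega)
      (by have := j.val_lt; simp only [Set.mem_setOf_eq]; omega) hij
    exact ZMod.val_injective n this
  -- all cycle vertices are in `W` and pairwise in one class
  have hW : ∀ i, x i ∈ W := fun i => (targetGraph_adj_mem (hcyc i)).1
  have hRel : ∀ i j, R (x i) (x j) := by
    have hstep : ∀ i, R (x i) (x (i + 1)) := fun i => targetGraph_adj_rel hRs (hcyc i)
    have hnat : ∀ (k : ℕ) (i : ZMod n), R (x i) (x (i + (k : ZMod n))) := by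
      intro k
      induction k with
      | zero => intro i; simpa using hRt (hstep i) (hRs (hstep i))
      | succ k ih =>
        intro i
        have := hRt (ih i) (hstep (i + (k : ZMod n)))
        push_cast
        rwa [← add_assoc]
    intro i j
    have := hnat (j - i).val i
    rwa [ZMod.natCast_zmod_val, add_sub_cancel] at this
  -- (1) the two cycle neighbours of `x i` lie in one branch at `x i`
  have hne1 : ∀ i : ZMod n, x (i + 1) ≠ x i := fun i h =>
    ZMod.self_ne_add_one (by omega) i (hinj h).symm
  have hbranch : ∀ i, AvoidReach Γ (x i) (x (i + 1)) (x (i - 1)) := by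
    intro i
    -- the walk `x(i+1), x(i+2), …, x(i+1+k)` along the cycle avoids `x i` while `k + 2 ≤ n`… we
    -- build it for all `k ≤ n - 2`
    have hwalk : ∀ k : ℕ, k + 2 ≤ n →
        ∃ q : (targetGraph Γ W R ℓ).Walk (x (i + 1)) (x (i + 1 + (k : ZMod n))), x i ∉ q.support := by
      intro k hk
      induction k with
      | zero =>
        refine ⟨(Walk.nil : (targetGraph Γ W R ℓ).Walk (x (i + 1)) (x (i + 1))).copy rfl (by simp), ?_⟩
        simp only [Walk.support_copy, Walk.support_nil, List.mem_singleton]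
        exact fun h => hne1 i h.symm
      | succ k ih =>
        obtain ⟨q, hq⟩ := ih (by omega)
        refine ⟨(q.append (Walk.cons (hcyc (i + 1 + (k : ZMod n))) Walk.nil)).copy rfl
          (by push_cast; ring), ?_⟩
        rw [Walk.support_copy, Walk.mem_support_append_iff, not_or]
        refine ⟨hq, ?_⟩
        simp only [Walk.support_cons, Walk.support_nil, List.mem_cons, List.not_mem_nil, or_false,
          not_or]
        constructor
        · intro h
          have h' := hinj h
          have : (((k + 1 : ℕ)) : ZMod n) = 0 := by
            calc ((k + 1 : ℕ) : ZMod n) = i + 1 + (k : ZMod n) - i := by push_cast; ring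
              _ = 0 := by rw [← h', sub_self]
          rw [ZMod.natCast_eq_zero_iff] at this
          have := Nat.le_of_dvd (by omega) this
          omega
        · intro h
          have h' := hinj h
          have : (((k + 2 : ℕ)) : ZMod n) = 0 := by
            calc ((k + 2 : ℕ) : ZMod n) = i + 1 + (k : ZMod n) + 1 - i := by push_cast; ring
              _ = 0 := by rw [← h', sub_self]
          rw [ZMod.natCast_eq_zero_iff] at this
          have := Nat.le_of_dvd (by omega) this
          omega
    obtain ⟨q, hq⟩ := hwalk (n - 2) (by omega)
    have hend : i + 1 + ((n - 2 : ℕ) : ZMod n) = i - 1 := by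
      have h1 : ((n - 2 : ℕ) : ZMod n) + 2 = 0 := by
        have : ((n - 2 + 2 : ℕ) : ZMod n) = 0 := by rw [Nat.sub_add_cancel (by omega), ZMod.natCast_self]
        push_cast at this
        exact this
      calc i + 1 + ((n - 2 : ℕ) : ZMod n) = i - 1 + (((n - 2 : ℕ) : ZMod n) + 2) := by ring
        _ = i - 1 := by rw [h1, add_zero]
    have key : ∀ (q' : (targetGraph Γ W R ℓ).Walk (x (i + 1)) (x (i - 1))), x i ∉ q'.support →
        AvoidReach Γ (x i) (x (i + 1)) (x (i - 1)) := fun q' hq' =>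
      @targetGraph_walk_avoidReach V Γ W R ℓ hRs hRt (x i) (hW i) (x (i + 1)) (x (i - 1)) q' hq'
        (hRel _ _) (hne1 i)
    refine key (q.copy rfl (congrArg x hend)) ?_
    rw [Walk.support_copy]
    exact hq
  -- (2) no vertex points to both cycle neighbours
  have hout : ∀ i, ¬ (Points Γ W R ℓ (x i) (x (i - 1)) ∧ Points Γ W R ℓ (x i) (x (i + 1))) := by
    rintro i ⟨⟨-, u, hu⟩, ⟨-, u', hu'⟩⟩
    have hb1 : AvoidReach Γ (x i) u (x (i - 1)) := hu.1.1
    have hb2 : AvoidReach Γ (x i) u' (x (i + 1)) := hu'.1.1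
    have huu' : AvoidReach Γ (x i) u u' := (hb1.trans (hbranch i).symm).trans hb2.symm
    have hcand := cand_eq_of_avoidReach (W := W) (R := R) huu'
    have hu'' : IsTarget Γ W R ℓ (x i) u (x (i + 1)) :=
      ⟨hcand ▸ hu'.1, fun z hz => hu'.2 z (hcand ▸ hz)⟩
    exact ZMod.sub_one_ne_add_one hn3 i (hinj (hu.unique hℓ hu''))
  -- (3) the key inequalities
  have hkey : ∀ i, Points Γ W R ℓ (x i) (x (i + 1)) →
      Γ.edist (x i) (x (i + 1)) < Γ.edist (x i) (x (i - 1)) ∨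
        (Γ.edist (x i) (x (i + 1)) = Γ.edist (x i) (x (i - 1)) ∧ ℓ (x (i + 1)) < ℓ (x (i - 1))) := by
    rintro i ⟨-, u, hu⟩
    have hz : x (i - 1) ∈ cand Γ W R (x i) u :=
      ⟨hu.1.1.trans (hbranch i), hu.1.2.1.trans (hbranch i).reachable, hW _, hRel _ _⟩
    exact hu.key_lt hℓ hz (fun h => ZMod.sub_one_ne_add_one hn3 i (hinj h))
  have hkey' : ∀ i, Points Γ W R ℓ (x i) (x (i - 1)) →
      Γ.edist (x i) (x (i - 1)) < Γ.edist (x i) (x (i + 1)) ∨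
        (Γ.edist (x i) (x (i - 1)) = Γ.edist (x i) (x (i + 1)) ∧ ℓ (x (i - 1)) < ℓ (x (i + 1))) := by
    rintro i ⟨-, u, hu⟩
    have hz : x (i + 1) ∈ cand Γ W R (x i) u :=
      ⟨hu.1.1.trans (hbranch i).symm, hu.1.2.1.trans (hbranch i).symm.reachable, hW _, hRel _ _⟩
    exact hu.key_lt hℓ hz (fun h => ZMod.sub_one_ne_add_one hn3 i (hinj h).symm)
  have hadj' : ∀ i, Points Γ W R ℓ (x i) (x (i + 1)) ∨ Points Γ W R ℓ (x (i + 1)) (x i) :=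
    fun i => (hcyc i).2
  exact cyclic_false hn3 (x := x) (Pt := Points Γ W R ℓ) (d := fun a b => Γ.edist a b) (ℓ := ℓ)
    hadj' hout (fun a b => SimpleGraph.edist_comm) hkey hkey'

end Acyclic

end Literature.Barriers.CriticalPhenomena
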